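import Literature.Claims.NS.Passolungo2025
import Mathlib.Analysis.SpecialFunctions.NonIntegrable
import HarnessLib

/-!
# C144 `Passolungo2025` — refuter kit (ns-claims-refuter-2 g6, D-0090 NS-CLAIMS SWEEP)

Text of record: S. Passolungo, «Navier–Stokes Global Regularity via Ledger, Windows, Curve-GIL, and a
Bubble-Tree Carleson Structure», Zenodo 17251544 (2025-10-02), 10 pp. (pp.1–5 English, pp.6–10 the
same text in Italian; PDF page = cited page); skeleton `Literature.Claims.NS.Passolungo2025`
(typist-6 g5, p523658, tree sha16 57d3b90c5962cf87).

## What this file proves (kernel EVIDENCE for the verdict «does not compose at §13»)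

The skeleton types the chain §§7–13 over the UNINTERPRETED signature `Gadgets` (no symbol of the
chain is defined in print) and types the closing clause §13 p.5 l.5 «Integrating and using μ gives
∫₀ᵀ ‖S‖_∞ dt < ∞» as the implication it asserts,
`Step9_Integration : ∀ G T u, 0 < T → Step7_CarlesonMass G T → Step8_LayerCake G T u →
strainSupIntegral T u < ⊤` — the only binder of `claim_of_steps` besides `GadgetsExist`.

* `not_Step9_Integration : ¬ Step9_Integration` — the printed laws consumed at §13 (Step 7 «μ(I) ≤
  C·E₀», §12 p.5 l.1–2, and the two layer-cake displays of Step 8, §13 p.5 l.4–5) do NOT entail the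
  integral bound: for the field `uW t x = ⌈t⁻¹⌉₊ • x` (strain `⌈t⁻¹⌉₊ • Id`, `‖S(t)‖_∞ = ⌈t⁻¹⌉₊`,
  `∫₀¹ ‖S‖_∞ = ∞`) there are gadgets `GW` — ALL FINITE: `E₀ = Cμ = Clc = 1`, `J = 0`, `L = 1`
  (non-empty dyadic blocks), `a 0 t = ⌈t⁻¹⌉₊`, `a k t = 0` (k ≥ 1), `θ_m = m`,
  `A_{0,θ_m} = {t : ⌈t⁻¹⌉₊ = m}`, `μ ≡ 0` — satisfying Step 7 and Step 8 on `[0,1)`.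
  The witness meets every side condition of the referee's charitable re-typing `Step9_Charitable`
  (ref-4 g5 FORMAL-PREP 10:34:20Z: `1 ≤ L`, `Clc ≠ ⊤`, `Cμ·E₀ ≠ ⊤`, low frequencies `k < J` void)
  EXCEPT the unprinted link R-a `∫_I Σ_m θ_m 1_{A_{r,θ_m}} ≤ μ(I)`: `levels_lintegral_eq_top` shows
  that link fails for `GW` (left side `= ∞`, `μ = 0`). So the kernel pins the non-composition of
  §13 exactly on the never-printed relation between `A_{r,θ}` and `μ` (typist's flag, REF R-a).
* `exists_gadgets_step7_step8` — for EVERY map `u : ℝ → E3 → E3` there are gadgets obeying Step 7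
  and Step 8 (with `ℝ≥0∞`-valued level sums; the referee's junk observation, recorded for the census:
  the interface carries no information about `u`).

This is NOT a «false lemma» of the print (nothing print-faithful can be a countermodel where the
symbols are undefined — KILL ROUTE 5b, REF PRE-READ 10:31:05Z); it is the kernel face of the class
«unfilled gap (does not compose)» at `Step9_Integration`.

WHAT THIS IS NOT: not a claim about NS regularity or blow-up; not a claim about any author beyond
the typed locator.
-/

open scoped ENNReal Topology
open Set MeasureTheory Filter

set_option linter.dupNamespace false

namespace Summit.NavierStokesRegularity.NavierStokesRegularity.Theorems.Passolungo2025

open Literature.Claims.NS.Passolungo2025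
open Literature.Claims.NS.PaiLimsuwan2026 (E3 strain)

noncomputable section

/-! ## The witness field `uW t x = ⌈t⁻¹⌉₊ • x` and its strain -/

/-- The integer amplitude `n(t) = ⌈t⁻¹⌉₊` (so `n(0) = 0`, `n(t) ≥ 1/t` for `t > 0`). [folklore] -/
def nW (t : ℝ) : ℕ := ⌈t⁻¹⌉₊

/-- The witness field `uW t x = n(t) • x` (a dilation field; any map is admissible in
`Step9_Integration`, which carries no solution hypothesis). [folklore] -/
def uW (t : ℝ) (x : E3) : E3 := (nW t : ℝ) • x

/-- `c • Id` is self-adjoint on `ℝ³`. [folklore] -/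
theorem adjoint_smul_id (c : ℝ) :
    ContinuousLinearMap.adjoint (c • ContinuousLinearMap.id ℝ E3) = c • ContinuousLinearMap.id ℝ E3 := by
  have h := (ContinuousLinearMap.eq_adjoint_iff (c • ContinuousLinearMap.id ℝ E3)
    (c • ContinuousLinearMap.id ℝ E3)).2 (fun x y => by
      simp [real_inner_smul_left, real_inner_smul_right])
  exact h.symm

/-- The strain of the dilation field is `n(t) • Id` at every point. [folklore] -/
theorem strain_uW (t : ℝ) (x : E3) :
    strain (uW t) x = (nW t : ℝ) • ContinuousLinearMap.id ℝ E3 := by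
  have hu : uW t = ⇑((nW t : ℝ) • ContinuousLinearMap.id ℝ E3) := by
    funext y; simp [uW]
  unfold strain
  rw [hu, ContinuousLinearMap.fderiv, adjoint_smul_id, ← two_smul ℝ ((nW t : ℝ) • _), smul_smul]
  norm_num

/-- `‖S(t,x)‖ = n(t)`. [folklore] -/
theorem norm_strain_uW (t : ℝ) (x : E3) : ‖strain (uW t) x‖ = (nW t : ℝ) := by
  rw [strain_uW, norm_smul, ContinuousLinearMap.norm_id, mul_one, Real.norm_eq_abs,
    abs_of_nonneg (Nat.cast_nonneg _)]

/-- `‖S(t)‖_{L^∞} = n(t)` in `ℝ≥0∞`. [folklore] -/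
theorem ssup_uW (t : ℝ) : (⨆ x : E3, ‖strain (uW t) x‖ₑ) = (nW t : ℝ≥0∞) := by
  have h : ∀ x : E3, ‖strain (uW t) x‖ₑ = (nW t : ℝ≥0∞) := fun x => by
    rw [← ofReal_norm, norm_strain_uW, ENNReal.ofReal_natCast]
  simp [h]

/-- `∫₀ᵀ t⁻¹ dt = ∞` as a lower Lebesgue integral over `(0,T)`, `T > 0`. [folklore] -/
theorem lintegral_inv_Ioo_eq_top {T : ℝ} (hT : 0 < T) :
    ∫⁻ t in Ioo 0 T, ENNReal.ofReal t⁻¹ = ⊤ := by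
  have hni : ¬ IntegrableOn (fun t : ℝ => t⁻¹) (Ioo 0 T) volume := by
    rw [← intervalIntegrable_iff_integrableOn_Ioo_of_le hT.le, intervalIntegrable_inv_iff]
    rintro (h | h)
    · exact hT.ne h
    · exact h left_mem_uIcc
  have hmeas : AEStronglyMeasurable (fun t : ℝ => t⁻¹) (volume.restrict (Ioo 0 T)) :=
    measurable_inv.aestronglyMeasurable
  have htop : ∫⁻ t in Ioo 0 T, ‖t⁻¹‖ₑ = ⊤ := by
    by_contra h
    exact hni ⟨hmeas, lt_top_iff_ne_top.2 h⟩
  rw [← htop]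
  refine setLIntegral_congr_fun measurableSet_Ioo (fun t ht => ?_)
  exact (Real.enorm_eq_ofReal (inv_nonneg.2 ht.1.le)).symm

/-- `∫₀ᵀ ‖S‖_∞ = ∞` for the witness field (`n(t) ≥ t⁻¹`). [folklore] -/
theorem strainSupIntegral_uW {T : ℝ} (hT : 0 < T) : strainSupIntegral T uW = ⊤ := by
  unfold strainSupIntegral
  simp_rw [ssup_uW]
  refine eq_top_iff.2 ?_
  rw [← lintegral_inv_Ioo_eq_top hT]
  refine lintegral_mono fun t => ?_
  rw [← ENNReal.ofReal_natCast]
  exact ENNReal.ofReal_le_ofReal (Nat.le_ceil _)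

/-! ## The gadgets `GW` (all finite) obeying Step 7 and Step 8 for `uW` -/

/-- Gadgets for the witness: `E₀ = Cμ = Clc = 1`, `J = 0`, `L = 1`, `a 0 t = n(t)`, `a k t = 0`
(`k ≥ 1`), `θ_m = m`, `A_{0,m} = {t : n(t) = m}`, `A_{r,m} = ∅` (`r ≥ 1`), `μ ≡ 0`; the symbols
not consumed at §13 are set to `0` (`σ = 1/8`). [folklore] -/
def GW : Gadgets where
  E₀ := 1
  fluxPlus := fun _ _ => 0
  influx := fun _ _ => 0
  NN := fun _ _ => 0
  EB := fun _ _ => 0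
  K := fun _ => 0
  cν := 0
  Cloc := 0
  ce := 0
  cstar := 0
  Cwi := 0
  cgil := 0
  σ := 1 / 8
  δ := fun _ => 0
  qener := fun _ _ => 0
  q := fun _ _ => 0
  gil := fun _ => 0
  a := fun k t => if k = 0 then (nW t : ℝ≥0∞) else 0
  J := 0
  L := 1
  θlev := fun m => (m : ℝ≥0∞)
  A := fun r m => if r = 0 then {t : ℝ | nW t = m} else ∅
  μ := fun _ => 0
  Cμ := 1
  Clc := 1

/-- The level sum `Σ_m θ_m 1_{A_{0,θ_m}}(t)` of `GW` equals `n(t)`. [folklore] -/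
theorem levels_GW (t : ℝ) : (∑' m : ℕ, GW.θlev m * (GW.A 0 m).indicator 1 t) = (nW t : ℝ≥0∞) := by
  rw [tsum_eq_single (nW t)]
  · simp [GW]
  · intro m hm
    have ht : t ∉ ({s : ℝ | nW s = m} : Set ℝ) := fun h => hm h.symm
    simp [GW, Set.indicator_of_notMem ht]

/-- Step 7 «μ(I) ≤ C·E₀» holds for `GW` (`μ ≡ 0`). [folklore] -/
theorem step7_GW (T : ℝ) : Step7_CarlesonMass GW T := fun _ _ _ _ _ => zero_le

/-- Step 8 (both layer-cake displays) holds for `GW` and `uW`. [folklore] -/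
theorem step8_GW (T : ℝ) : Step8_LayerCake GW T uW := by
  refine ⟨fun t _ => ?_, fun r t _ => ?_⟩
  · rw [ssup_uW]
    refine le_trans ?_ (le_of_eq (one_mul _).symm)
    refine le_trans (le_of_eq ?_) (ENNReal.le_tsum 0)
    simp [GW]
  · rcases Nat.eq_zero_or_pos r with hr | hr
    · subst hr
      rw [levels_GW t]
      simp [GW]
    · have ha : ∀ k ∈ Finset.Ico (GW.J + r * GW.L) (GW.J + (r + 1) * GW.L),
          (2 : ℝ≥0∞) ^ ((k : ℝ) / 2) * GW.a k t = 0 := by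
        intro k hk
        have hk' : k ≠ 0 := by
          simp only [GW, Finset.mem_Ico] at hk
          omega
        simp [GW, hk']
      rw [Finset.sum_eq_zero ha]
      exact zero_le

/-! ## Headline -/

/-- **`¬ Step9_Integration`** (§13 «7. Layer-cake and BKM», p.5 l.5 «Integrating and using μ gives
∫_0^T ||S||_∞ dt < ∞»): at `T = 1` the gadgets `GW` obey Step 7 and Step 8 for the field `uW`,
whose strain sup integrates to `∞`. Kernel face of «unfilled gap (does not compose)»: the printed
hypotheses of §13 never relate `A_{r,θ}` to `μ`. [cite: Passolungo2025, §13 p.5 l.3–5] -/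
theorem not_Step9_Integration : ¬ Step9_Integration := fun h =>
  (h GW 1 uW one_pos (step7_GW 1) (step8_GW 1)).ne (strainSupIntegral_uW one_pos)

/-! ## Where exactly the link is missing (the referee's R-a) -/

/-- For `GW` the unprinted link «`∫_I Σ_m θ_m 1_{A_{r,θ_m}} ≤ μ(I)`» (REF R-a) FAILS on `I = [0,T]`,
`T > 0`: the left side is `∫₀ᵀ ⌈t⁻¹⌉₊ dt = ∞` while `μ ≡ 0` — every other side condition of the
charitable re-typing (`L = 1`, finite constants, no low frequencies) is met by `GW`. [folklore] -/
theorem levels_lintegral_eq_top {T : ℝ} (hT : 0 < T) :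
    (∫⁻ t in Icc 0 T, ∑' m : ℕ, GW.θlev m * (GW.A 0 m).indicator 1 t) = ⊤ ∧ GW.μ (Icc 0 T) = 0 := by
  refine ⟨eq_top_iff.2 ?_, rfl⟩
  rw [← strainSupIntegral_uW hT]
  unfold strainSupIntegral
  simp_rw [levels_GW, ssup_uW]
  exact lintegral_mono_set Ioo_subset_Icc_self

/-- The finite bookkeeping of `GW` (the referee's side conditions): `L = 1`, `J = 0`, `Clc = 1`,
`Cμ * E₀ = 1`. [folklore] -/
theorem GW_sideConditions : GW.L = 1 ∧ GW.J = 0 ∧ GW.Clc = 1 ∧ GW.Cμ * GW.E₀ = 1 := by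
  refine ⟨rfl, rfl, rfl, ?_⟩
  simp [GW]

/-! ## The interface carries no information about `u` (junk record) -/

/-- For EVERY map `u` there are gadgets obeying Step 7 and Step 8 on `[0,T)` (`a_k(t) = ‖S(t)‖_∞`
for all `k`, all levels active: `θ ≡ 1`, `A ≡ univ`, so the level sum is `∞`; `μ ≡ 0`). Hence §13's
one-clause inference has no content at the typed grain. [folklore] -/
theorem exists_gadgets_step7_step8 (T : ℝ) (u : ℝ → E3 → E3) :
    ∃ G : Gadgets, Step7_CarlesonMass G T ∧ Step8_LayerCake G T u := by
  refine ⟨{ GW with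
      a := fun _ t => (⨆ x : E3, ‖strain (u t) x‖ₑ)
      θlev := fun _ => 1
      A := fun _ _ => univ }, fun _ _ _ _ _ => zero_le, fun t _ => ?_, fun r t _ => ?_⟩
  · refine le_trans ?_ (le_of_eq (one_mul _).symm)
    refine le_trans (le_of_eq ?_) (ENNReal.le_tsum 0)
    simp
  · have htop : (∑' _ : ℕ, (1 : ℝ≥0∞) * (univ : Set ℝ).indicator 1 t) = ⊤ := by
      simp
    rw [htop]
    simp [GW]

end

end Summit.NavierStokesRegularity.NavierStokesRegularity.Theorems.Passolungo2025
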